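/-
Copyright: the b2b-balaban T⁴-continuum CRUX team, row NE7b OWNER lineage `t4-ne7b-p1` (gen 122). Project licence.
-/
import Summits.QuantumFields.BalabanUV.T4Continuum.Spine.NE7b.SupTorusPerturbedResponse

/-!
# AN EXPONENTIALLY LOCAL KERNEL PRESERVES EXPONENTIAL SUP PROFILES ON THE BLOCK SCALE: `|u| ≤ Se^{−δρ_s(bt ·, y₀)}`, `|K(x,z)| ≤
# εe^{−γρ_N(x,z)}`, `0 ≤ δ < γ` ⟹ `|(Ku)(x)| ≤ εK_{γ−δ}e^{2dδ}·S·e^{−δρ_s(bt x, y₀)}` — the input letter of the pointwise-decay re-run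
# ((153)∕(154)) for the perturbed Hessian `H + K`: the kernel term enters the Poisson equation like the potential term, with the SAME
# profile and NO loss of rate (row NE7b, node U5c; (133)∕(163)∕(168) BY NAME; [folklore])

Cell `pub-balaban`, sub-cell `t4`, spine estimate NE7b (`T4WeightBudget.RelWeightBound`; the cell's OWN estimate — NOT PRINTED in
[Bałaban 1983–89], NOT PROVED).  Crux-route work under `Spine/NE7b/` by the row OWNER (`t4-ne7b-p1` gen 122, file (172)) under FREEZE
(0)'s crux-prover clause; NOTHING of Bałaban's is named as a Lean object, valued or asserted; no `T4Continuum/Support` leaf typed; no `def`,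
no notation; zero `sorry`.  Imports (BY NAME): the OWNER's (168) `…SupTorusPerturbedResponse` (`kernelSum_anti`; through it (163)
`weighted_rowsum_le`, `distance_weight_lipschitz`, (133) `weight_on_block`, (61)-style `siteOf_chart_surjective`, `blockOf_siteOf_of_mem`).

WHY (located).  (170) showed that the `ℓ^∞` BOUND of `(H + K)⁻¹` follows from (152) by perturbation, but NOT the pointwise DECAY: (154)
returns the rate `min(κ, γ∕2)` for a source of rate `γ`, so `Hu = f − Ku` cannot be closed by absorption in a weighted sup norm.  The
decay must be re-run inside (154)'s interior-estimate argument, where the kernel term `Ku` is absorbed like the potential term `Vu` —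
for which one needs exactly this letter: `Ku` has the same block-scale sup profile as `u`, with the mesh-free factor `εK_{γ−δ}e^{2dδ}`.
The proof conjugates `K` by the FINE weight `w = (δ∕(n+1))ρ_N(·, corner of y₀)` — `(δ∕(n+1))`-Lipschitz in `ρ_N` by the triangle
inequality ((163) `distance_weight_lipschitz`), so the conjugated row sums are `≤ εK_{γ−δ∕(n+1)} ≤ εK_{γ−δ}` ((163), (168)
`kernelSum_anti`) — and compares `w` with the block weight `δρ_s(bt ·, y₀)` up to `±dδ` ((133) `weight_on_block`).

WHAT IS PROVED ([folklore]; fine torus `Site d ((n+1)s)`, coarse `Site d s`; `bt x = σ_s(blk n (wm x))`; `K_α = (2∕(1 − e^{−α}))^d`):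
* §1 `fine_weight_compare` (`δ ≥ 0`: `δρ_s(bt x, y₀) − dδ ≤ (δ∕(n+1))ρ_N(x, σ(chart (wm y₀) 0)) ≤ δρ_s(bt x, y₀) + dδ` at EVERY fine `x`).
* §2 **`kernel_supProfile_le`** (`ε ≥ 0`, `0 ≤ δ < γ`, `|K(x,z)| ≤ εe^{−γρ_N(x,z)}`, `|u z| ≤ Se^{−δρ_s(bt z, y₀)}` ∀ `z` ⟹ at every `x`:
  `|Σ_z K(x,z)u(z)| ≤ εK_{γ−δ}e^{2dδ}·S·e^{−δρ_s(bt x, y₀)}`).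
* §3 toy.

HONEST (what this is NOT).  A letter; the pointwise decay of `(H + K)⁻¹f` itself remains the re-run of (153)∕(154) with this letter
in the place of the potential bound; cubic periods; scalar skeleton ((A3), NC-NE7b-α UNRULED); nothing of Bałaban's.  BY-NAME EFFECT ON
THE WALL: NONE.  NE7b NOT PRINTED ∕ NOT PROVED; spine PROVED 0∕9; rung (B)+1 on a FINITE torus — NOT infinite volume, NOT the mass gap, NOT
Clay.  HONEST DEPENDENCY: continuum YM on T⁴ ⇐ BetaPertH ∧ nine spine estimates (0∕9 proved); BetaPertH ⇐ (D1) ∧ (D4) ∧ CAP+tail; G-an2-4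
gates asym, D1 and NE2∕3∕4.
-/

set_option autoImplicit false

noncomputable section

namespace Summit.QuantumFields.BalabanUV.T4Continuum.NE7b.SupTorusPerturbedKernelProfile

open Real
open Literature.MathematicalPhysics.QuantumFieldTheory.Balaban1983to89
open B6QGQLower276 (X e blk B side chart mem_B sum_B sum_B_const card_cube blk_chart)
open Beta (Site siteOf windowMap siteOf_windowMap siteOf_add)
open SupTorusDirichletForm (siteOf_chart_surjective blockOf_siteOf_of_mem)
open SupTorusActionForm (weight_on_block)
open SupTorusPerturbedKernelSums (weighted_rowsum_le distance_weight_lipschitz)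
open SupTorusPerturbedResponse (kernelSum_anti)

variable {d : ℕ}

/-! ## §1. The fine weight to the corner of `y₀` vs the block weight -/

/-- **THE FINE WEIGHT AND THE BLOCK WEIGHT AGREE UP TO `±dδ`**: for every fine `x` and `δ ≥ 0`, with `c′ = σ(chart (wm y₀) 0)`:
`δρ_s(bt x, y₀) − dδ ≤ (δ∕(n+1))ρ_N(x, c′) ≤ δρ_s(bt x, y₀) + dδ` ((133) `weight_on_block` at `x = σ(chart (wm (bt x)) z)`). [folklore] -/
theorem fine_weight_compare (n s : ℕ) [NeZero s] (y₀ : Site d s) {δ : ℝ} (hδ : 0 ≤ δ) (x : Site d ((n + 1) * s)) :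
    δ * (∑ i, ((((siteOf d s (blk n (windowMap d ((n + 1) * s) x))) i - y₀ i).valMinAbs.natAbs : ℕ) : ℝ)) - d * δ
        ≤ δ / ((n : ℝ) + 1) * ∑ i, (((x i - (siteOf d ((n + 1) * s) (chart n (windowMap d s y₀) 0)) i).valMinAbs.natAbs : ℕ) : ℝ)
      ∧ δ / ((n : ℝ) + 1) * ∑ i, (((x i - (siteOf d ((n + 1) * s) (chart n (windowMap d s y₀) 0)) i).valMinAbs.natAbs : ℕ) : ℝ)
        ≤ δ * (∑ i, ((((siteOf d s (blk n (windowMap d ((n + 1) * s) x))) i - y₀ i).valMinAbs.natAbs : ℕ) : ℝ)) + d * δ := by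
  obtain ⟨⟨y, z⟩, hx⟩ := siteOf_chart_surjective n s x
  simp only at hx
  have hy : siteOf d s (blk n (windowMap d ((n + 1) * s) x)) = y := by
    rw [← hx]; exact blockOf_siteOf_of_mem n s (mem_B.2 (blk_chart n (windowMap d s y) z))
  rw [hy, ← hx]
  exact weight_on_block n s y y₀ z hδ

/-! ## §2. A local kernel preserves block-scale exponential sup profiles -/

/-- **A LOCAL KERNEL PRESERVES EXPONENTIAL SUP PROFILES**: `ε ≥ 0`, `0 ≤ δ < γ`, `|K(x,z)| ≤ εe^{−γρ_N(x,z)}`, `|u z| ≤ Se^{−δρ_s(bt z, y₀)}`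
for all `z` ⟹ `|Σ_z K(x,z)u(z)| ≤ εK_{γ−δ}e^{2dδ}·S·e^{−δρ_s(bt x, y₀)}` at EVERY `x` — conjugation by the fine weight `(δ∕(n+1))ρ_N(·, c′)`
((163) `weighted_rowsum_le` with `distance_weight_lipschitz`), §1 twice, and `K_{γ−δ∕(n+1)} ≤ K_{γ−δ}` ((168) `kernelSum_anti`). [folklore] -/
theorem kernel_supProfile_le (n s : ℕ) [NeZero s] {ε γ δ S : ℝ} (hε : 0 ≤ ε) (hδ : 0 ≤ δ) (hδγ : δ < γ)
    (K : Site d ((n + 1) * s) → Site d ((n + 1) * s) → ℝ)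
    (hK : ∀ x z, |K x z| ≤ ε * exp (-(γ * ∑ i, (((x i - z i).valMinAbs.natAbs : ℕ) : ℝ))))
    (y₀ : Site d s) (u : Site d ((n + 1) * s) → ℝ)
    (hu : ∀ z, |u z| ≤ S * exp (-(δ * ∑ i, ((((siteOf d s (blk n (windowMap d ((n + 1) * s) z))) i - y₀ i).valMinAbs.natAbs : ℕ) : ℝ))))
    (x : Site d ((n + 1) * s)) :
    |∑ z, K x z * u z| ≤ ε * (2 * (1 - exp (-(γ - δ)))⁻¹) ^ d * exp (2 * d * δ) * S
      * exp (-(δ * ∑ i, ((((siteOf d s (blk n (windowMap d ((n + 1) * s) x))) i - y₀ i).valMinAbs.natAbs : ℕ) : ℝ))) := by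
  classical
  have hd : (0 : ℝ) ≤ d := Nat.cast_nonneg d
  have hn : (0 : ℝ) < (n : ℝ) + 1 := by positivity
  have hn1 : (1 : ℝ) ≤ (n : ℝ) + 1 := by have := Nat.cast_nonneg (α := ℝ) n; linarith
  have hS : 0 ≤ S := by
    by_contra hS'
    exact absurd ((abs_nonneg (u x)).trans (hu x)) (not_le.2 (mul_neg_of_neg_of_pos (not_le.1 hS') (exp_pos _)))
  have hθ0 : 0 ≤ δ / ((n : ℝ) + 1) := div_nonneg hδ hn.le
  have hθδ : δ / ((n : ℝ) + 1) ≤ δ := div_le_self hδ hn1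
  have hθγ : δ / ((n : ℝ) + 1) < γ := lt_of_le_of_lt hθδ hδγ
  -- the conjugated row sum at the fine weight `(δ∕(n+1))ρ_N(·, c′)`
  have hrow := weighted_rowsum_le ((n + 1) * s) K
    (fun x' => δ / ((n : ℝ) + 1) * ∑ i, (((x' i - (siteOf d ((n + 1) * s) (chart n (windowMap d s y₀) 0)) i).valMinAbs.natAbs : ℕ) : ℝ))
    hε hK (fun x' z' => distance_weight_lipschitz ((n + 1) * s) hθ0 _ x' z') hθγ x
  beta_reduce at hrow
  have hKmono : (2 * (1 - exp (-(γ - δ / ((n : ℝ) + 1))))⁻¹) ^ d ≤ (2 * (1 - exp (-(γ - δ)))⁻¹) ^ d :=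
    kernelSum_anti (d := d) (sub_pos.2 hδγ) (by linarith)
  -- termwise: `|K(x,z)u(z)| ≤ Se^{2dδ}e^{−δρ_s(bt x,y₀)}·|K(x,z)|e^{w x − w z}`
  have hterm : ∀ z, |K x z * u z| ≤ S * exp (2 * d * δ) * exp (-(δ * ∑ i, ((((siteOf d s (blk n (windowMap d ((n + 1) * s) x))) i - y₀ i).valMinAbs.natAbs : ℕ) : ℝ)))
      * (|K x z| * exp (δ / ((n : ℝ) + 1) * ∑ i, (((x i - (siteOf d ((n + 1) * s) (chart n (windowMap d s y₀) 0)) i).valMinAbs.natAbs : ℕ) : ℝ)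
          - δ / ((n : ℝ) + 1) * ∑ i, (((z i - (siteOf d ((n + 1) * s) (chart n (windowMap d s y₀) 0)) i).valMinAbs.natAbs : ℕ) : ℝ))) := by
    intro z
    have hz := (fine_weight_compare n s y₀ hδ z).2
    have hx := (fine_weight_compare n s y₀ hδ x).1
    have e1 : exp (-(δ * ∑ i, ((((siteOf d s (blk n (windowMap d ((n + 1) * s) z))) i - y₀ i).valMinAbs.natAbs : ℕ) : ℝ)))
        ≤ exp (d * δ) * exp (-(δ / ((n : ℝ) + 1) * ∑ i, (((z i - (siteOf d ((n + 1) * s) (chart n (windowMap d s y₀) 0)) i).valMinAbs.natAbs : ℕ) : ℝ))) := by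
      rw [← exp_add]; exact exp_le_exp.2 (by linarith)
    have e2 : exp (-(δ / ((n : ℝ) + 1) * ∑ i, (((x i - (siteOf d ((n + 1) * s) (chart n (windowMap d s y₀) 0)) i).valMinAbs.natAbs : ℕ) : ℝ)))
        ≤ exp (d * δ) * exp (-(δ * ∑ i, ((((siteOf d s (blk n (windowMap d ((n + 1) * s) x))) i - y₀ i).valMinAbs.natAbs : ℕ) : ℝ))) := by
      rw [← exp_add]; exact exp_le_exp.2 (by linarith)
    have e3 : exp (-(δ / ((n : ℝ) + 1) * ∑ i, (((z i - (siteOf d ((n + 1) * s) (chart n (windowMap d s y₀) 0)) i).valMinAbs.natAbs : ℕ) : ℝ)))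
        = exp (-(δ / ((n : ℝ) + 1) * ∑ i, (((x i - (siteOf d ((n + 1) * s) (chart n (windowMap d s y₀) 0)) i).valMinAbs.natAbs : ℕ) : ℝ)))
          * exp (δ / ((n : ℝ) + 1) * ∑ i, (((x i - (siteOf d ((n + 1) * s) (chart n (windowMap d s y₀) 0)) i).valMinAbs.natAbs : ℕ) : ℝ)
            - δ / ((n : ℝ) + 1) * ∑ i, (((z i - (siteOf d ((n + 1) * s) (chart n (windowMap d s y₀) 0)) i).valMinAbs.natAbs : ℕ) : ℝ)) := by
      rw [← exp_add]; congr 1; ring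
    have e4 : exp (2 * d * δ) = exp (d * δ) * exp (d * δ) := by rw [← exp_add]; congr 1; ring
    have hKa : 0 ≤ |K x z| := abs_nonneg _
    rw [abs_mul]
    calc |K x z| * |u z| ≤ |K x z| * (S * exp (-(δ * ∑ i, ((((siteOf d s (blk n (windowMap d ((n + 1) * s) z))) i - y₀ i).valMinAbs.natAbs : ℕ) : ℝ)))) := mul_le_mul_of_nonneg_left (hu z) hKa
      _ ≤ |K x z| * (S * (exp (d * δ) * exp (-(δ / ((n : ℝ) + 1) * ∑ i, (((z i - (siteOf d ((n + 1) * s) (chart n (windowMap d s y₀) 0)) i).valMinAbs.natAbs : ℕ) : ℝ))))) :=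
          mul_le_mul_of_nonneg_left (mul_le_mul_of_nonneg_left e1 hS) hKa
      _ = |K x z| * (S * exp (d * δ)) * exp (δ / ((n : ℝ) + 1) * ∑ i, (((x i - (siteOf d ((n + 1) * s) (chart n (windowMap d s y₀) 0)) i).valMinAbs.natAbs : ℕ) : ℝ)
            - δ / ((n : ℝ) + 1) * ∑ i, (((z i - (siteOf d ((n + 1) * s) (chart n (windowMap d s y₀) 0)) i).valMinAbs.natAbs : ℕ) : ℝ))
          * exp (-(δ / ((n : ℝ) + 1) * ∑ i, (((x i - (siteOf d ((n + 1) * s) (chart n (windowMap d s y₀) 0)) i).valMinAbs.natAbs : ℕ) : ℝ))) := by rw [e3]; ring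
      _ ≤ |K x z| * (S * exp (d * δ)) * exp (δ / ((n : ℝ) + 1) * ∑ i, (((x i - (siteOf d ((n + 1) * s) (chart n (windowMap d s y₀) 0)) i).valMinAbs.natAbs : ℕ) : ℝ)
            - δ / ((n : ℝ) + 1) * ∑ i, (((z i - (siteOf d ((n + 1) * s) (chart n (windowMap d s y₀) 0)) i).valMinAbs.natAbs : ℕ) : ℝ))
          * (exp (d * δ) * exp (-(δ * ∑ i, ((((siteOf d s (blk n (windowMap d ((n + 1) * s) x))) i - y₀ i).valMinAbs.natAbs : ℕ) : ℝ)))) := mul_le_mul_of_nonneg_left e2 (by positivity)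
      _ = _ := by rw [e4]; ring
  calc |∑ z, K x z * u z| ≤ ∑ z, |K x z * u z| := Finset.abs_sum_le_sum_abs _ _
    _ ≤ ∑ z, S * exp (2 * d * δ) * exp (-(δ * ∑ i, ((((siteOf d s (blk n (windowMap d ((n + 1) * s) x))) i - y₀ i).valMinAbs.natAbs : ℕ) : ℝ)))
        * (|K x z| * exp (δ / ((n : ℝ) + 1) * ∑ i, (((x i - (siteOf d ((n + 1) * s) (chart n (windowMap d s y₀) 0)) i).valMinAbs.natAbs : ℕ) : ℝ)
          - δ / ((n : ℝ) + 1) * ∑ i, (((z i - (siteOf d ((n + 1) * s) (chart n (windowMap d s y₀) 0)) i).valMinAbs.natAbs : ℕ) : ℝ))) := Finset.sum_le_sum fun z _ => hterm z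
    _ = S * exp (2 * d * δ) * exp (-(δ * ∑ i, ((((siteOf d s (blk n (windowMap d ((n + 1) * s) x))) i - y₀ i).valMinAbs.natAbs : ℕ) : ℝ)))
        * ∑ z, |K x z| * exp (δ / ((n : ℝ) + 1) * ∑ i, (((x i - (siteOf d ((n + 1) * s) (chart n (windowMap d s y₀) 0)) i).valMinAbs.natAbs : ℕ) : ℝ)
          - δ / ((n : ℝ) + 1) * ∑ i, (((z i - (siteOf d ((n + 1) * s) (chart n (windowMap d s y₀) 0)) i).valMinAbs.natAbs : ℕ) : ℝ)) := (Finset.mul_sum _ _ _).symm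
    _ ≤ S * exp (2 * d * δ) * exp (-(δ * ∑ i, ((((siteOf d s (blk n (windowMap d ((n + 1) * s) x))) i - y₀ i).valMinAbs.natAbs : ℕ) : ℝ)))
        * (ε * (2 * (1 - exp (-(γ - δ / ((n : ℝ) + 1))))⁻¹) ^ d) := mul_le_mul_of_nonneg_left hrow (by positivity)
    _ ≤ S * exp (2 * d * δ) * exp (-(δ * ∑ i, ((((siteOf d s (blk n (windowMap d ((n + 1) * s) x))) i - y₀ i).valMinAbs.natAbs : ℕ) : ℝ)))
        * (ε * (2 * (1 - exp (-(γ - δ)))⁻¹) ^ d) := mul_le_mul_of_nonneg_left (mul_le_mul_of_nonneg_left hKmono hε) (by positivity)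
    _ = _ := by ring

/-! ## §3. Toy -/

/-- Toy (`d = 0`): the constant `εK_{γ−δ}e^{2dδ}` at `ε = 0` vanishes. -/
example (γ δ : ℝ) : (0 : ℝ) * (2 * (1 - exp (-(γ - δ)))⁻¹) ^ (0 : ℕ) * exp (2 * ((0 : ℕ) : ℝ) * δ) = 0 := by simp

end Summit.QuantumFields.BalabanUV.T4Continuum.NE7b.SupTorusPerturbedKernelProfile
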